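import Literature.AnabelianGeometry.EtaleTheta.GalSectCor28iiEndKnit
import HarnessLib

/-!
# [GalSect] §4 / [EtTh] Cor. 2.8 (ii): "preserved by `Γ`" PINS the target structure — without any cusp-pair
# hypothesis (proof-only)

Mochizuki, *The étale theta function …* [EtTh], Publ. RIMS **45** (2009), Thm. 1.10 (iii) p.256, Cor. 2.8 (ii) p.268
[cite: MochizukiEtTh2009, Cor 2.8 (ii) p.42]; [GalSect] §4 [cite: MochizukiGalSect2005, §4 p.33].  abc-iut cell, layer
L2, seat abc-iut-w5-d062 (gen 3).  PROOF-ONLY: no definitions, no named facts.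

Strengthening of `PreservedBy.eq_image_classTransport` (p433009), which assumed `P.map Γ = P'`: the conclusion
`R' = e '' R` needs only the MEMBERS clause of `PreservedBy` and that `e` is `S ↦ Γ S` on classes.  Consequence
for ROW (B): `Cor28iiAt.eq_image_of_witness` — ANY witness family of the typed `Cor28iiAt` is equivariant for every
admissible class transport, with NO hypothesis on `Δ^tp_C` (sharpens `Cor28iiAt.image_classTransport_eq`, p436362,
which assumed the `L`-automorphisms stabilise `Δ^tp_C`).  HONEST FRAMING: bookkeeping; typed ≠ proved; no side
taken on [IUTchIII] Cor. 3.12.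
-/

noncomputable section

namespace Literature.AnabelianGeometry.EtaleTheta

open scoped Pointwise

namespace GalSect

namespace CuspPair

variable {G G' : Type*} [Group G] [TopologicalSpace G] [Group G'] [TopologicalSpace G']
  {P : CuspPair G} {P' : CuspPair G'} {Γ : G ≃ₜ* G'}

/-- **"Preserved by `Γ`" pins the target structure**: if `Γ` carries the member splittings of `R` onto those
of `R'` and `e` is `S ↦ Γ S` on classes, then `R' = e '' R` — no cusp-pair hypothesis needed.
[cite: MochizukiEtTh2009, Thm 1.10 (iii) p.30] -/
theorem PreservedBy.eq_image {R : Set P.SplittingClass} {R' : Set P'.SplittingClass} (h : P.PreservedBy P' Γ R R')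
    {e : P.SplittingClass → P'.SplittingClass}
    (he : ∀ (S : Subgroup G) (hS : S ∈ P.splittings),
      ∃ h', e (SplittingClass.mk P S hS) = SplittingClass.mk P' (S.map Γ.toMulEquiv.toMonoidHom) h') :
    R' = e '' R := by
  obtain ⟨-, hmem⟩ := h
  ext c'
  constructor
  · intro hc'
    obtain ⟨S', hS'mem, hS', rfl⟩ := exists_members_of_mem hc'
    have : S' ∈ (fun S => S.map Γ.toMulEquiv.toMonoidHom) '' P.members R := by rw [hmem]; exact hS'mem
    obtain ⟨S, ⟨hS, hSR⟩, rfl⟩ := this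
    obtain ⟨h', he'⟩ := he S hS
    exact ⟨_, hSR, by rw [he']⟩
  · rintro ⟨c, hc, rfl⟩
    obtain ⟨S, hS, rfl⟩ := SplittingClass.exists_rep P c
    have hSmem : S.map Γ.toMulEquiv.toMonoidHom ∈ P'.members R' := by
      rw [← hmem]; exact ⟨S, ⟨hS, hc⟩, rfl⟩
    obtain ⟨hS', hR'⟩ := hSmem
    obtain ⟨h', he'⟩ := he S hS
    rw [he']
    exact hR'

/-- Hence "preserved by `Γ`" holds for `(R, R')` IFF `R'` is the transport of `R` — given that `Γ` carries `P.D`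
onto `P'.D` and the member images are splittings (e.g. `P.map Γ = P'`). [cite: MochizukiEtTh2009, Thm 1.10 (iii) p.30] -/
theorem preservedBy_iff_eq_image [IsTopologicalGroup G] (hpair : P.map Γ = P')
    {e : P.SplittingClass → P'.SplittingClass}
    (he : ∀ (S : Subgroup G) (hS : S ∈ P.splittings),
      ∃ h', e (SplittingClass.mk P S hS) = SplittingClass.mk P' (S.map Γ.toMulEquiv.toMonoidHom) h')
    (R : Set P.SplittingClass) (R' : Set P'.SplittingClass) :
    P.PreservedBy P' Γ R R' ↔ R' = e '' R :=
  ⟨fun h => h.eq_image he, fun h => h ▸ preservedBy_image_classTransport hpair he R⟩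

end CuspPair

end GalSect

namespace ThetaCovers

namespace TemperedCoverData

universe u

variable {l : ℕ} (T : TemperedCoverData.{u} l)

/-- **Any witness family of the typed `Cor28iiAt` IS equivariant** — for every `L`-automorphism `Γ` and cusp
`g`, at the cusp `g'` the witness provides, EVERY map `e` that is `S ↦ Γ S` on classes satisfies
`R g' = e '' R g`; no hypothesis on `Δ^tp_C` (sharpens `Cor28iiAt.image_classTransport_eq`).
[cite: MochizukiEtTh2009, Cor 2.8 (ii) p.42] -/
theorem Cor28iiAt.eq_image_of_witness {S : Subgroup T.Gtp} {L : List (Subgroup T.Gtp)} {n : ℕ}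
    {A : Type u} [Group A] {𝒟 : T.Cor28iiData S A} (h28 : T.Cor28iiAt S L n 𝒟) (hμ : T.HasMuL)
    (hres : 𝒟.ResCharPrimeToL) (hrat : ∀ g, T.IsRationalCusp S g) :
    ∃ R : ∀ g : T.Gtp, Set (T.cuspPairAt S g).SplittingClass,
      (∀ g, (𝒟.torsor g).IsSubStructure (𝒟.mu n) (𝒟.canonical g) (R g)) ∧
      ∀ Γ : T.Gtp ≃ₜ* T.Gtp, (∀ S' ∈ L, S'.map Γ.toMulEquiv.toMonoidHom = S') →
        ∀ g, ∃ g', ∀ (e : (T.cuspPairAt S g).SplittingClass → (T.cuspPairAt S g').SplittingClass),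
          (∀ (S₁ : Subgroup T.Gtp) (hS₁ : S₁ ∈ (T.cuspPairAt S g).splittings),
            ∃ h', e (GalSect.CuspPair.SplittingClass.mk _ S₁ hS₁) =
              GalSect.CuspPair.SplittingClass.mk _ (S₁.map Γ.toMulEquiv.toMonoidHom) h') →
          R g' = e '' R g := by
  obtain ⟨R, hR, hΓ⟩ := h28 hμ hres hrat
  refine ⟨R, hR, fun Γ hL g => ?_⟩
  obtain ⟨g', hpres⟩ := hΓ Γ hL g
  exact ⟨g', fun e he => hpres.eq_image he⟩

end TemperedCoverData

end ThetaCovers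

end Literature.AnabelianGeometry.EtaleTheta

end
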